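import Mathlib
import Summits.Ventures.HodgeRepro2.T6NAut

/-!
# T6Composition — the M2 composition over `NAut` (TARGET-T6 v0.4 §9.2(c)), the logic

Cell pub-hodge-repro2, Tier 6 (README §10), seat t6-lead (gen 2). The M2 contract is
`periodInputN_of_published (P : NDatum F) (M : NAut F P) (displays…) [residuals] :
∃ c, P.AdmChoice c ∧ Hyp.PeriodN (P.shadow c)`; here the six owners' mains enter as BINDERS stated in
`NAut`'s vocabulary (§9.3 — the conclusion of each `*_main (P) (M) …`), so that the final theorem is
this one applied to the owners' theorems by name once their wrappers are in the tree. The logic is the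
Tier-5 assembly (N0.4)/(N0.P4) of `T5Assembly.ND_of_N4_N5`: (N4) and (N5) give Proposition N*'s
hypotheses (i) and (ii) on both sides; (N3) on each side gives `ℓ_A ≠ 0`, `ℓ_B ≠ 0`; the isotypic step
(N3iso) produces an admissible choice `c` whose pairing `⟨F_A, F_B⟩_c` is non-zero; (N1) turns the
non-zero pairing into `I_{τ₁}(D, c) ≠ 0`; `T6NDatum.periodN_of_I_ne_zero` is `Hyp.PeriodN (P.shadow c)`.

N2 (the admissibility of the datum) is not load-bearing in this logic — it is the precondition under
which the datum of (N3) exists as constructed (TIER5 N0.4); it enters the final theorem as the binder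
`hN2 : M.AdmDatum` once `NAut` v2 carries t6-p2's datum (v1 scope note in `T6NAut`).

§8(d): uses an L-value-free non-vanishing device: NO.
-/

namespace Summit.Ventures.HodgeRepro2.T6

variable {K : Type*} [Field K] [NumberField K] {F : FaceSetting K}

/-- THE M2 COMPOSITION, the logic over `NAut` (TARGET-T6 v0.4 §9.2(c)): from the conclusions of the
owners' mains — N1 (`∀ c, AdmChoice c → ⟨F_A, F_B⟩_c ≠ 0 → I_{τ₁}(D, c) ≠ 0`), N3 on both sides
(`(i) → (ii) → ℓ ≠ 0`) with the isotypic step (`ℓ_A ≠ 0 → ℓ_B ≠ 0 → ∃ c admissible, ⟨F_A, F_B⟩_c ≠ 0`),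
N4 (`(i)` on both sides) and N5 (both toric periods non-zero on the level parts) — an admissible choice
`c` with `Hyp.PeriodN (P.shadow c)`: the (N) input of Theorem A (`T6N.periodInputN_of_hyp`). -/
theorem periodInputN_of_mains (P : NDatum F) (M : NAut F P)
    (hN1 : ∀ c, P.AdmChoice c → M.pairing c ≠ 0 → P.I P.τ₁ c ≠ 0)
    (hN3A : M.iA → M.iiA → M.ellA) (hN3B : M.iB → M.iiB → M.ellB)
    (hN3iso : M.ellA → M.ellB → ∃ c, P.AdmChoice c ∧ M.pairing c ≠ 0)
    (hN4 : M.iA ∧ M.iB) (hN5 : M.N5) :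
    ∃ c, P.AdmChoice c ∧ Hyp.PeriodN (P.shadow c) := by
  obtain ⟨hiiA, hiiB⟩ := M.iiA_and_iiB_of_N5 hN5
  obtain ⟨c, hc, hp⟩ := hN3iso (hN3A hN4.1 hiiA) (hN3B hN4.2 hiiB)
  exact ⟨c, hc, P.periodN_of_I_ne_zero (hN1 c hc hp)⟩

/-- The same with N4 in N4.1's words (`R1AndHloc` on both sides) and the Rallis inner-product bridge
«(R1) ∧ (H_loc) ⇒ (i)» on each side as a binder (t6-p4's display over `(M.d3.A, M.sA.d41)`, GQT 2014
Thm. 11.7(ii) / Yamana 2014). -/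
theorem periodInputN_of_mains' (P : NDatum F) (M : NAut F P)
    (hN1 : ∀ c, P.AdmChoice c → M.pairing c ≠ 0 → P.I P.τ₁ c ≠ 0)
    (hN3A : M.iA → M.iiA → M.ellA) (hN3B : M.iB → M.iiB → M.ellB)
    (hN3iso : M.ellA → M.ellB → ∃ c, P.AdmChoice c ∧ M.pairing c ≠ 0)
    (hN4 : M.N4) (hRallisA : M.sA.R1AndHloc → M.iA) (hRallisB : M.sB.R1AndHloc → M.iB)
    (hN5 : M.N5) :
    ∃ c, P.AdmChoice c ∧ Hyp.PeriodN (P.shadow c) :=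
  periodInputN_of_mains P M hN1 hN3A hN3B hN3iso ⟨hRallisA hN4.1, hRallisB hN4.2⟩ hN5

end Summit.Ventures.HodgeRepro2.T6
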